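import Summits.CriticalPhenomena.PercolationContinuityZ3.Theorems.PercExchangeRateTransportCriticalCurveRegular

/-!
# fwd-rung G1 gen 9 over `CriticalCurveRegular` (seed g1-CriticalPhenomena-16065) — banked candidate C1
# `SubcurveSharpness`: sharpness (exponential one-arm decay) strictly BELOW the anisotropic critical curve

Graded family `SubcurveSharpWithin T` := (floor `CriticalCurveRegular`, verbatim) ∧
(∀ `t ∈ T ∩ (0,1)`, ∀ `p ∈ [0, p_c(t))`, ∃ `C, c > 0`, ∀ `n`, `Θₙ(p,t) ≤ C·exp(−c n)`), where `Θₙ(p,t)` is the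
probability (label-coupled anisotropic bond family on `ℤ²×ℤ`: x/y-bonds open iff `U_e ≤ p`, z-bonds iff
`U_e ≤ t`) that the cluster of the origin reaches the boundary of the box `Λₙ`.  `T = ∅` IS the floor
(`subcurveSharpWithin_empty_iff`); the candidate rung is `T = univ`.

Role of the floor: continuity of `p_c(·)` makes every point strictly below the curve strictly subcritical
along every coordinatewise-increasing ray through it (the ray stays below the curve for a while), so the
Duminil-Copin–Tassion / OSSS sharp-threshold argument along rays (one-parameter monotone weighted families;
tree: `Literature.Probability.Percolation.SharpnessDCTProofs`, `…SharpnessQuasiTransitiveProofs` for the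
HOMOGENEOUS family only) would give the decay; and pointwise decay + the floor ⇒ decay uniform on compact
subsets of the open sub-curve region (`Θₙ` is monotone in both parameters and every sub-curve point is
dominated by a sub-curve point `(p+δ, t+δ)`).

Status w.r.t. the Statement `θ_{ℤ³}(p_c) = 0`: S-SILENT (neither implies the other by tree theorems) — hence
NOT an on-path forward rung (F4); banked as a G3-import seed / K⁻ support statement.  No sorry.
-/

namespace Summit.CriticalPhenomena.PercolationContinuityZ3.Cruxes.SubcritExchangeUniformity.SubcurveSharp

open Summit.CriticalPhenomena.PercolationContinuityZ3.Theses.PercExchangeRateTransport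

/-- Graded family: the floor `CriticalCurveRegular` (verbatim `let`-objects `μ, vert, cfg, θ, pc` of the
route, plus the route's finite-volume one-arm probability `Θ`) together with exponential decay of
`Θₙ(p,t)` at every level `t ∈ T ∩ (0,1)` and every `0 ≤ p < p_c(t)`. -/
def SubcurveSharpWithin (T : Set ℝ) : Prop :=
  let μ := Literature.Probability.Percolation.labelMeasure (Literature.Probability.LatticeModels.Site 3); let vert : Sym2 (Literature.Probability.LatticeModels.Site 3) → Prop := fun e => ∃ x : Literature.Probability.LatticeModels.Site 3, e = s(x, x + Pi.single (2 : Fin 3) 1); let cfg : ℝ → ℝ → (Sym2 (Literature.Probability.LatticeModels.Site 3) → ℝ) → Set (Sym2 (Literature.Probability.LatticeModels.Site 3)) := fun p t U => {e | e ∈ (Literature.Probability.LatticeModels.zdGraph 3).edgeSet ∧ ((vert e ∧ U e ≤ t) ∨ (¬ vert e ∧ U e ≤ p))}; let Θ : ℕ → ℝ → ℝ → ℝ := fun n p t => μ.real {U | cfg p t U ∈ Literature.Probability.Percolation.siteToBoundary 3 n}; let θ : ℝ → ℝ → ℝ := fun p t => μ.real {U | cfg p t U ∈ Literature.Probability.Percolation.percolatesAt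 (0 : Literature.Probability.LatticeModels.Site 3)}; let pc : ℝ → ℝ := fun t => sInf ({p : ℝ | 0 ≤ p ∧ p ≤ 1 ∧ 0 < θ p t} ∪ {1}); (ContinuousOn pc (Set.Ioo 0 1) ∧ ∀ t ∈ Set.Ioo (0 : ℝ) 1, 0 < pc t ∧ pc t < 1) ∧ ∀ t ∈ T, t ∈ Set.Ioo (0 : ℝ) 1 → ∀ p : ℝ, 0 ≤ p → p < pc t → ∃ C c : ℝ, 0 < c ∧ ∀ n : ℕ, Θ n p t ≤ C * Real.exp (-(c * n))

/-- Candidate rung C1 (`T = univ`): sharpness strictly below the whole anisotropic critical curve. -/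
def SubcurveSharpness : Prop := SubcurveSharpWithin Set.univ

/-- **F3 witness: the floor is the `T = ∅` member of the family** (term proof from the seed, no sorry). -/
theorem subcurveSharpWithin_empty : SubcurveSharpWithin ∅ := by
  unfold SubcurveSharpWithin
  exact ⟨Summit.CriticalPhenomena.PercolationContinuityZ3.Cruxes.CriticalCurveRegular.Locmod.CriticalCurveRegular_proof,
    fun t ht => (Set.notMem_empty t ht).elim⟩

/-- The same by `simpa` from the seed. -/
example : SubcurveSharpWithin ∅ := by
  simpa [SubcurveSharpWithin, CriticalCurveRegular] using
    Summit.CriticalPhenomena.PercolationContinuityZ3.Cruxes.CriticalCurveRegular.Locmod.CriticalCurveRegular_proof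

/-- The floor is literally the `T = ∅` member (both directions). -/
theorem subcurveSharpWithin_empty_iff : SubcurveSharpWithin ∅ ↔ CriticalCurveRegular := by
  unfold SubcurveSharpWithin CriticalCurveRegular
  exact ⟨fun h => h.1, fun h => ⟨h, fun t ht => (Set.notMem_empty t ht).elim⟩⟩

/-- The family is antitone in `T`. -/
theorem subcurveSharpWithin_mono {T T' : Set ℝ} (h : T ⊆ T') :
    SubcurveSharpWithin T' → SubcurveSharpWithin T := by
  unfold SubcurveSharpWithin
  intro h'
  exact ⟨h'.1, fun t ht => h'.2 t (h ht)⟩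

/-- In particular the rung hands back the floor (tagged so that the tribunal's cheap `Rung → floor`
portfolio (`intro; aesop`) can see it). -/
@[aesop safe forward] theorem floor_of_rung : SubcurveSharpness → CriticalCurveRegular := fun h =>
  subcurveSharpWithin_empty_iff.1 (subcurveSharpWithin_mono (Set.empty_subset _) h)

/-- Named form `<floor>_of_<rung>` of the same implication. -/
theorem criticalCurveRegular_of_subcurveSharpness (h : SubcurveSharpness) : CriticalCurveRegular :=
  floor_of_rung h

end Summit.CriticalPhenomena.PercolationContinuityZ3.Cruxes.SubcritExchangeUniformity.SubcurveSharp
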